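import Summits.Ventures.CertifiedManyBodySolver.Downfold.EmeryBoxesNdNiO2JetWindowP1
import Summits.Ventures.CertifiedManyBodySolver.Downfold.EmeryFermiFillingLa214
import HarnessLib

/-!
# THE WHOLE-BAND (OBJECT-M) ONE-BAND SET AS CERTIFIED WINDOWS — NdNiO₂, ν = 0.41 — ASSEMBLED: `(t_J, t′_J/t_J, t″_J/t_J)` of the nodal 2-jet at ε_F
# for EVERY member of box #21's σ companion `emeryBoxNdNiO2YK26` (INFL-3to1-B §B.101)

Venture CertifiedManyBodySolver, cell `pub/hubbard-downfold` (stage S1; INFLATION-RULES-3to1-B §B.101), seat hubbard-downfold-mod-4 (technique B = band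
level, g45); namespace `Summit.Ventures.CertifiedManyBodySolver.Downfold.Emery`. Everything PROVED (`decide +kernel` on the bisection certificates of
`EmeryBandJetWindow.jetLeaf` — slope arithmetic `EmerySlopeArith(Sound)` — composed with the sub-box ε_F brackets of `EmeryFermiFillingNdNiO2Subs` and
`abFilling_fermiEnergyOf'`; generator HOME/hubbard-downfold-mod-4/jet-g45/gen/emit_boxes2.py, bit-exact python mirror of the kernel checker).
WHAT THIS IS NOT: a statement about NdNiO₂ — the typed box (box #21's σ companion `emeryBoxNdNiO2YK26` (NdNiO₂; Δ_pd [3.97, 6.24] × t_pd [1.17, 1.37] × t_pp [0.56, 0.68] × t_pp′ [0.121, 0.123] eV)) is SCREENING-GRADE; `U = 0` one-body kinematics of the σ model; the ε_F coupling is per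
SUB-BOX (each member's jet is bounded over its sub-box's certified ε_F bracket, not at its own ε_F), so the windows are OUTER bounds of the true ranges.

| Δ_pd range | window |
|---|---|
| whole Δ_pd hull [3.97, 6.24] | t_J [0.1890, 0.4090] eV, t′_J/t_J [-0.1462, -0.0360], t″_J/t_J [0.0177, 0.1267] |

Sources: [HybertsenSchluterChristensen1989, Eq. (1)]; [AndersenEtAl1995, §6]; [PavariniEtAl2001, Eq. (1)]; interval/slope arithmetic [folklore].
-/

noncomputable section

namespace Summit.Ventures.CertifiedManyBodySolver.Downfold.Emery

open Real Set Literature.Analysis.ValidatedNumerics.Numerics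

/-- **NdNiO₂, whole Δ_pd hull [3.97, 6.24], ν = 0.41** — for EVERY member θ = (Δ, t_pd, t_pp, t_pp′), with ε = ε_F(θ) and x₀ = xNode(ε_F): nodal-jet hopping
`t_J ∈ [0.1890, 0.4090]` eV, `t′_J/t_J ∈ [-0.1462, -0.0360]`, `t″_J/t_J ∈ [0.0177, 0.1267]` (union of the sub-box windows 0_0, 0_1, 1_0, 1_1, 2_0, 2_1, 3_0, 3_1, 4_0, 4_1, 5_0, 5_1). [folklore] -/
theorem ndNiO2Box_jetWindow_nu041 {Δ a b c : ℝ} (hΔ : Δ ∈ Icc (397 / 100 : ℝ) (156 / 25 : ℝ)) (ha : a ∈ Icc (117 / 100 : ℝ) (137 / 100 : ℝ))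
    (hb : b ∈ Icc (14 / 25 : ℝ) (17 / 25 : ℝ)) (hc : c ∈ Icc (121 / 1000 : ℝ) (123 / 1000 : ℝ)) :
    jetT Δ a b c (xNode Δ a b c (fermiEnergyOf Δ a b c (41 / 100 : ℝ))) (fermiEnergyOf Δ a b c (41 / 100 : ℝ)) ∈ Icc (189 / 1000 : ℝ) (409 / 1000 : ℝ) ∧
      jetTp Δ a b c (xNode Δ a b c (fermiEnergyOf Δ a b c (41 / 100 : ℝ))) (fermiEnergyOf Δ a b c (41 / 100 : ℝ)) / jetT Δ a b c (xNode Δ a b c (fermiEnergyOf Δ a b c (41 / 100 : ℝ))) (fermiEnergyOf Δ a b c (41 / 100 : ℝ)) ∈ Icc (-731 / 5000 : ℝ) (-9 / 250 : ℝ) ∧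
      jetTpp Δ a b c (xNode Δ a b c (fermiEnergyOf Δ a b c (41 / 100 : ℝ))) (fermiEnergyOf Δ a b c (41 / 100 : ℝ)) / jetT Δ a b c (xNode Δ a b c (fermiEnergyOf Δ a b c (41 / 100 : ℝ))) (fermiEnergyOf Δ a b c (41 / 100 : ℝ)) ∈ Icc (177 / 10000 : ℝ) (1267 / 10000 : ℝ) := by
  rcases mem_Icc_split hΔ (5 : ℝ) with hΔ | hΔ
  · rcases mem_Icc_split hΔ (857 / 200 : ℝ) with hΔ | hΔ
    · rcases mem_Icc_split ha (127 / 100 : ℝ) with ha' | ha'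
      · exact (ndNiO2Jet_0_0 hΔ ha' hb hc).widen (by norm_num [SC]) (by norm_num [SC]) (by norm_num [SC])
          (by norm_num [SC]) (by norm_num [SC]) (by norm_num [SC])
      · exact (ndNiO2Jet_0_1 hΔ ha' hb hc).widen (by norm_num [SC]) (by norm_num [SC]) (by norm_num [SC])
          (by norm_num [SC]) (by norm_num [SC]) (by norm_num [SC])
    · rcases mem_Icc_split hΔ (23 / 5 : ℝ) with hΔ | hΔ
      · rcases mem_Icc_split ha (127 / 100 : ℝ) with ha' | ha'
        · exact (ndNiO2Jet_1_0 hΔ ha' hb hc).widen (by norm_num [SC]) (by norm_num [SC]) (by norm_num [SC])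
            (by norm_num [SC]) (by norm_num [SC]) (by norm_num [SC])
        · exact (ndNiO2Jet_1_1 hΔ ha' hb hc).widen (by norm_num [SC]) (by norm_num [SC]) (by norm_num [SC])
            (by norm_num [SC]) (by norm_num [SC]) (by norm_num [SC])
      · rcases mem_Icc_split ha (127 / 100 : ℝ) with ha' | ha'
        · exact (ndNiO2Jet_2_0 hΔ ha' hb hc).widen (by norm_num [SC]) (by norm_num [SC]) (by norm_num [SC])
            (by norm_num [SC]) (by norm_num [SC]) (by norm_num [SC])
        · exact (ndNiO2Jet_2_1 hΔ ha' hb hc).widen (by norm_num [SC]) (by norm_num [SC]) (by norm_num [SC])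
            (by norm_num [SC]) (by norm_num [SC]) (by norm_num [SC])
  · rcases mem_Icc_split hΔ (541 / 100 : ℝ) with hΔ | hΔ
    · rcases mem_Icc_split ha (127 / 100 : ℝ) with ha' | ha'
      · exact (ndNiO2Jet_3_0 hΔ ha' hb hc).widen (by norm_num [SC]) (by norm_num [SC]) (by norm_num [SC])
          (by norm_num [SC]) (by norm_num [SC]) (by norm_num [SC])
      · exact (ndNiO2Jet_3_1 hΔ ha' hb hc).widen (by norm_num [SC]) (by norm_num [SC]) (by norm_num [SC])
          (by norm_num [SC]) (by norm_num [SC]) (by norm_num [SC])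
    · rcases mem_Icc_split hΔ (291 / 50 : ℝ) with hΔ | hΔ
      · rcases mem_Icc_split ha (127 / 100 : ℝ) with ha' | ha'
        · exact (ndNiO2Jet_4_0 hΔ ha' hb hc).widen (by norm_num [SC]) (by norm_num [SC]) (by norm_num [SC])
            (by norm_num [SC]) (by norm_num [SC]) (by norm_num [SC])
        · exact (ndNiO2Jet_4_1 hΔ ha' hb hc).widen (by norm_num [SC]) (by norm_num [SC]) (by norm_num [SC])
            (by norm_num [SC]) (by norm_num [SC]) (by norm_num [SC])
      · rcases mem_Icc_split ha (127 / 100 : ℝ) with ha' | ha'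
        · exact (ndNiO2Jet_5_0 hΔ ha' hb hc).widen (by norm_num [SC]) (by norm_num [SC]) (by norm_num [SC])
            (by norm_num [SC]) (by norm_num [SC]) (by norm_num [SC])
        · exact (ndNiO2Jet_5_1 hΔ ha' hb hc).widen (by norm_num [SC]) (by norm_num [SC]) (by norm_num [SC])
            (by norm_num [SC]) (by norm_num [SC]) (by norm_num [SC])

end Summit.Ventures.CertifiedManyBodySolver.Downfold.Emery
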